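import Mathlib.LinearAlgebra.Dual.Lemmas
import Mathlib.LinearAlgebra.FiniteDimensional.Basic
import Mathlib.Algebra.MvPolynomial.Equiv
import Mathlib.Algebra.Polynomial.Roots
import Literature.NumberTheory.Transcendental.DiazZeroLemmaProofs
import HarnessLib

/-!
# A zero lemma with multiplicities at the points `μ.v` (perturbed form), from Philippon's estimate

Topic `Literature/NumberTheory/Transcendental`. Support file (proofs only, no named fact) for the
large-transcendence-degree assertions that need Gel'fond's method WITH derivatives on
`𝔾ₐ × 𝔾ₘⁿ` — Laurent's transcription `Diaz1989_main_iii` of Diaz 1989 / Philippon 1986,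
Thm 2.12 (i) (`DiazMain.lean`: `t₃ = trdeg ℚ(xᵢ, yⱼ, e^{xᵢyⱼ}) ≥ mn/(m+n)`), its T.H. forms
`Diaz1989_gridXY` (`DiazGrid.lean`) and `Philippon1986_thm_2_12` (`PhilipponExpGrid.lean`).
In Philippon's criterion the auxiliary polynomial has to be shown non-degenerate at every point
`θ̃` of a small ball around `θ = (x, y, e^{xy})`, which is the rôle of a zero lemma "in perturbed
form": the multiplicity-free one of Diaz (J. Number Theory 31 (1989), pp. 11–12) is the tree's
`Diaz1989_zeroLemma`, derived in `DiazZeroLemmaProofs.lean` from Philippon's Théorème 2.1 at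
`T = 0` with its degree clause (`Philippon1986_GaGm_P1n`). Here we prove the analogue WITH
MULTIPLICITIES along the analytic line `ℂ·(1, ũ)`, from the multiplicity version of Philippon's
theorem vendored as `Philippon1986_GaGm` (`PhilipponZeroEstimate.lean`: `G = 𝔾ₐ × 𝔾ₘⁿ ⊂ ℙ¹ × ℙⁿ`,
unspecified constant `c(n)`, total degree in the torus variables, degree clause DROPPED) — and we
show that this weakened form suffices: the degree clause is replaced by an argument on the
exponents of the polynomial (`eq_zero_of_evalAt_translate`).

Main results (everything here is PROVED; `#print axioms` is the whitelist):

* `DiazZLM.zeroLemmaMult_of_GaGm (hZ : Philippon1986_GaGm)`: for `n ≥ 1` there is `c = c(n) ∈ ℕ`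
  such that for `m ≥ 1`, integers `B, D₀, D₁ ≥ 1`, `T ≥ 0`, reals `Δ ≥ π`, `V`, data
  `u, ũ ∈ ℂⁿ`, `v, θ ∈ ℂ^m`, `z ∈ ℂ^{n×m}` with `∑|z_hk - u_hv_k|, ∑|θ_k - v_k|, ∑|ũ_h - u_h| ≤ e^{-V}`,
  `∑|z_hk| ≤ Δ`, `π|u₁|, π|v₁| ≤ Δ`, and a non-zero `P ∈ ℂ[W₀, …, W_n]` with `deg_{W₀} P ≤ D₀`,
  `deg_{W_h} P ≤ D₁` vanishing to order `≥ (n+1)T + 1` along `ℂ·(1, ũ)` at the points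
  `σ(μ) = (μ.θ, (e^{μ.z_h})_h)`, `max μ_k ≤ (n+1)B`: if `c D₀ D₁ⁿ < (T+1)(B+1)^m` and
  `c D₁ⁿ < (T+1)(B+1)^{m-1}` then some `λ ∈ ℤⁿ ∖ 0`, `μ ∈ ℤ^m ∖ 0` have `|λ_h| ≤ D₁`,
  `|μ_k| ≤ D₁B²Δ`, `|λ.u|·|μ.v| ≤ D₁²B²Δ e^{-V}` (so that measures of linear independence of `u`
  and `v` at heights `D₁` and `D₁B²Δ` beating `e^{-V}` exclude the degeneration).
* `DiazZLM.zeroLemmaMult_of_GaGm'`: the same with the vanishing stated through ordinary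
  derivatives `(d/dt)^s P(σ(μ)·exp_G(t(1,ũ)))|_{t=0} = 0`, `s ≤ (n+1)T`, via
  `DiazZLM.vanishesToOrder_of_iteratedDeriv` (Fréchet derivatives on the line `ℂ·w₀` versus
  `iteratedDeriv` of `t ↦ P(g·exp_G(tw₀))`, which is smooth: `contDiff_evalAt_mul_exp_smul`).
* The algebra behind "no degree clause needed": `DiazZLM.exists_lin_form`, `DiazZLM.exists_torusPt` (for a saturated `A ≤ ℤⁿ` and `χ ∉ A` a
  point of the subtorus `T_A` where the character `χ` is `≠ 1`, by rational duality),
  `DiazZLM.eq_zero_of_eval_torus` (a polynomial of partial degrees `≤ D₁` vanishing on a translate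
  of `T_A` is zero as soon as `A` has no non-zero element in the box `max|χ_h| ≤ D₁` — Dedekind–Artin
  independence of the characters `w ↦ w^e` of `T_A`, `linearIndependent_monoidHom`),
  `DiazZLM.eq_zero_of_evalAt_translate` (the same for `ℂ × T_A ⊂ 𝔾ₐ × 𝔾ₘⁿ`), and the tangent
  computations `one_mem_tangent_iff`, `finrank_line_sub_eq_one` (`codim_W(W ∩ Lie G') ∈ {0, 1}`).

The proof of the zero lemma (ours — no printed source states this perturbed multiplicity form; the
pattern is Waldschmidt's adaptation of Philippon's theorem as reconstructed in
`DiazZeroLemmaProofs.lean`, whose points `σ`, pairing `pair`, lattice lemma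
`exists_indep_of_card_gt` and estimates `abs_t_le`, `norm_mul_norm_le`, `abs_comb_le` are reused):
with `Σ = σ([0,B]^m)`, `W = ℂ·(1,ũ)`, Philippon's inequality reads
`binom(T+s,s)·#(Σ/G')·D₀^{dim V}(nD₁)^{dim T_A} ≤ c D₀(nD₁)ⁿ` for an algebraic subgroup
`G' = V × T_A` lying in a translate of `𝒵(P)`, `s = 1 - dim(W ∩ Lie G')`. If `V = 0` then `s = 1`
and either two points of the box are congruent mod `G'` (`ν.θ = 0`, whence `|ν.v| ≤ Be^{-V}`) or
`(T+1)(B+1)^m ≤ cD₀(nD₁)ⁿ`. If `V = 𝔾ₐ` and `A` contains a non-zero `χ` with `max|χ_h| ≤ D₁`: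
when `(1,ũ) ∈ Lie G'`, `χ.ũ = 0` and `|χ.u| ≤ D₁e^{-V}`; otherwise `s = 1`,
`(T+1)·#(Σ/G') ≤ c(nD₁)ⁿ`, and either all classes meet the box in `≤ B+1` points
(`(T+1)(B+1)^{m-1} ≤ c(nD₁)ⁿ`) or one class contains three points not on a line, giving
`ν, ν'` independent with `χ.(ν.z), χ.(ν'.z) ∈ 2πiℤ` and a non-zero `ρ ∈ ℤν + ℤν'`,
`|ρ_k| ≤ D₁B²Δ/π`, with `χ.(ρ.z) = 0`, so `|χ.u||ρ.v| = |∑χ_hρ_k(u_hv_k - z_hk)| ≤ D₁·D₁B²Δ·e^{-V}`.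
If `V = 𝔾ₐ` and `A` has no such `χ`, `P` vanishes on a translate of `ℂ × T_A`, hence `P = 0`.

## References

* P. Philippon, *Lemmes de zéros dans les groupes algébriques commutatifs*, Bull. Soc. Math.
  France 114 (1986), 355–383, Théorème 2.1 (p. 358); Errata et addenda, ibid. 115 (1987),
  397–398. [Philippon1986]
* G. Diaz, *Grands degrés de transcendance pour des familles d'exponentielles*, J. Number Theory
  31 (1989), 1–23, §II-3-4, Lemme de zéros, pp. 11–12 (the multiplicity-free model). [Diaz1989]
* P. Philippon, *Critères pour l'indépendance algébrique*, Publ. Math. IHÉS 64 (1986), 5–52,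
  Théorème 2.12 (i), p. 40 (the application this serves). [Philippon1986Criteres]
* Yu. V. Nesterenko, P. Philippon (eds.), *Introduction to Algebraic Independence Theory*,
  LNM 1752, Springer 2001, Ch. 11 (D. Roy), Thm 4.1; Ch. 14 (M. Waldschmidt), §3.2.3.
  [NesterenkoPhilippon2001]
-/

noncomputable section

namespace Literature.NumberTheory.Transcendental

open Finset GaGm DiazZL

namespace DiazZLM

variable {n m : ℕ}

/-! ### Saturated lattices of characters: duality -/

/-- **Duality for saturated lattices**: if `A ≤ ℤⁿ` is saturated (`kχ ∈ A, k ≠ 0 ⇒ χ ∈ A`)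
and `χ ∉ A`, there is `w ∈ ℂⁿ` with `∑ χ'ⱼwⱼ = 0` for all `χ' ∈ A` and `∑ χⱼwⱼ = 1`. Indeed every
element of the `ℚ`-span of `A` in `ℚⁿ` is of the form `a/d` with `a ∈ A`, `d ∈ ℤ ∖ 0`, so `χ` is
outside that span, and a rational linear form vanishing on it and not at `χ` exists by duality
(`Subspace.forall_mem_dualAnnihilator_apply_eq_zero_iff`). [folklore] -/
theorem exists_lin_form {A : AddSubgroup (Fin n → ℤ)}
    (hsat : ∀ (k : ℤ) (χ : Fin n → ℤ), k ≠ 0 → k • χ ∈ A → χ ∈ A)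
    {χ : Fin n → ℤ} (hχ : χ ∉ A) :
    ∃ w : Fin n → ℂ, (∀ χ' ∈ A, ∑ j, (χ' j : ℂ) * w j = 0) ∧ ∑ j, (χ j : ℂ) * w j = 1 := by
  classical
  -- the coordinatewise cast `ι : ℤⁿ → ℚⁿ`
  set ι : (Fin n → ℤ) →+ (Fin n → ℚ) := (Int.castAddHom ℚ).compLeft (Fin n) with hι
  have ι_apply : ∀ (χ'' : Fin n → ℤ) (j : Fin n), ι χ'' j = (χ'' j : ℚ) := fun _ _ => rfl
  have ι_inj : Function.Injective ι := by
    intro χ₁ χ₂ h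
    funext j
    have := congrFun h j
    rw [ι_apply, ι_apply] at this
    exact_mod_cast this
  have ι_zsmul : ∀ (k : ℤ) (χ'' : Fin n → ℤ), ι (k • χ'') = (k : ℚ) • ι χ'' := fun k χ'' => by
    funext j
    rw [Pi.smul_apply, ι_apply, ι_apply]
    simp
  set S : Submodule ℚ (Fin n → ℚ) := Submodule.span ℚ (ι '' (A : Set (Fin n → ℤ))) with hS
  -- `ι χ ∉ S`: every `x ∈ S` has `d • x = ι a` with `a ∈ A`, `d ≠ 0`
  have hnot : ι χ ∉ S := by
    intro hmem
    have key : ∀ x ∈ S, ∃ d : ℤ, d ≠ 0 ∧ ∃ a ∈ A, ι a = (d : ℚ) • x := by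
      intro x hx
      induction hx using Submodule.span_induction with
      | mem x hx =>
          obtain ⟨a, ha, rfl⟩ := hx
          exact ⟨1, one_ne_zero, a, ha, by simp⟩
      | zero => exact ⟨1, one_ne_zero, 0, A.zero_mem, by simp⟩
      | add x y _ _ hx hy =>
          obtain ⟨d, hd, a, ha, hax⟩ := hx
          obtain ⟨d', hd', a', ha', hay⟩ := hy
          refine ⟨d * d', mul_ne_zero hd hd', d' • a + d • a', A.add_mem (A.zsmul_mem ha _)
            (A.zsmul_mem ha' _), ?_⟩
          rw [map_add, ι_zsmul, ι_zsmul, hax, hay, smul_add, smul_smul, smul_smul]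
          push_cast
          congr 1
          rw [mul_comm]
      | smul q x _ hx =>
          obtain ⟨d, hd, a, ha, hax⟩ := hx
          refine ⟨d * q.den, mul_ne_zero hd (by exact_mod_cast q.den_ne_zero), q.num • a,
            A.zsmul_mem ha _, ?_⟩
          rw [ι_zsmul, hax, smul_smul, smul_smul]
          push_cast
          congr 1
          have : (q.den : ℚ) * q = q.num := by
            have := Rat.mul_den_eq_num q
            rw [mul_comm] at this
            exact this
          calc (q.num : ℚ) * d = d * ((q.den : ℚ) * q) := by rw [this]; ring
            _ = (d : ℚ) * q.den * q := by ring
    obtain ⟨d, hd, a, ha, hax⟩ := key _ hmem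
    rw [← ι_zsmul] at hax
    have : a = d • χ := ι_inj hax
    exact hχ (hsat d χ hd (this ▸ ha))
  -- a rational linear form vanishing on `S` and not at `ι χ`
  obtain ⟨φ, hφS, hφχ⟩ : ∃ φ ∈ S.dualAnnihilator, φ (ι χ) ≠ 0 := by
    by_contra h
    push Not at h
    exact hnot ((Subspace.forall_mem_dualAnnihilator_apply_eq_zero_iff S _).mp h)
  rw [Submodule.mem_dualAnnihilator] at hφS
  -- the linear form in coordinates
  have hlin : ∀ χ'' : Fin n → ℤ, ∑ j, (χ'' j : ℚ) * φ (Pi.single j 1) = φ (ι χ'') := by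
    intro χ''
    have e : ι χ'' = ∑ j, (ι χ'' j) • (Pi.single j (1 : ℚ) : Fin n → ℚ) := pi_eq_sum_univ' (ι χ'')
    conv_rhs => rw [e, map_sum]
    refine Finset.sum_congr rfl fun j _ => ?_
    rw [map_smul, ι_apply, smul_eq_mul]
  refine ⟨fun j => ((φ (Pi.single j 1) / φ (ι χ) : ℚ) : ℂ), fun χ' hχ' => ?_, ?_⟩
  · have h0 : φ (ι χ') = 0 := hφS _ (Submodule.subset_span ⟨χ', hχ', rfl⟩)
    have : ∑ j, (χ' j : ℂ) * ((φ (Pi.single j 1) / φ (ι χ) : ℚ) : ℂ) =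
        ((∑ j, (χ' j : ℚ) * φ (Pi.single j 1)) / φ (ι χ) : ℚ) := by
      push_cast
      rw [Finset.sum_div]
      refine Finset.sum_congr rfl fun j _ => ?_
      ring
    rw [this, hlin χ', h0, zero_div, Rat.cast_zero]
  · have : ∑ j, (χ j : ℂ) * ((φ (Pi.single j 1) / φ (ι χ) : ℚ) : ℂ) =
        ((∑ j, (χ j : ℚ) * φ (Pi.single j 1)) / φ (ι χ) : ℚ) := by
      push_cast
      rw [Finset.sum_div]
      refine Finset.sum_congr rfl fun j _ => ?_
      ring
    rw [this, hlin χ, div_self hφχ, Rat.cast_one]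

/-- **A point of the subtorus `T_A` separating a character `χ ∉ A`** (`A` saturated): there is
`w ∈ (ℂˣ)ⁿ` with `w^{χ'} = 1` for all `χ' ∈ A` and `w^χ ≠ 1` (take `w = e^{v}` with `v` as in
`exists_lin_form`: `w^χ = e ≠ 1`). [folklore] -/
theorem exists_torusPt {A : AddSubgroup (Fin n → ℤ)}
    (hsat : ∀ (k : ℤ) (χ : Fin n → ℤ), k ≠ 0 → k • χ ∈ A → χ ∈ A)
    {χ : Fin n → ℤ} (hχ : χ ∉ A) :
    ∃ w : Fin n → ℂˣ, (∀ χ' ∈ A, ∏ j, (w j) ^ (χ' j) = 1) ∧ ∏ j, (w j) ^ (χ j) ≠ 1 := by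
  obtain ⟨v, hvA, hvχ⟩ := exists_lin_form hsat hχ
  refine ⟨(GaGm.exp ((0 : ℂ), v)).2, fun χ' hχ' => ?_, fun h1 => ?_⟩
  · rw [prod_zpow_exp_eq_one_iff]
    exact ⟨0, by rw [hvA χ' hχ']; simp⟩
  · rw [prod_zpow_exp_eq_one_iff] at h1
    obtain ⟨t, ht⟩ := h1
    rw [hvχ] at ht
    have := congrArg Complex.re ht
    simp at this

/-! ### A polynomial vanishing on a translate of `ℂ × T_A` vanishes, if `A` has no small character -/

/-- **Torus form.** Let `A ≤ ℤⁿ` be saturated with no non-zero element in the box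
`max |χⱼ| ≤ D₁`, and `Q ∈ ℂ[Y₁, …, Y_n]` with `deg_{Y_j} Q ≤ D₁` vanishing at `b·w` for every
`w ∈ T_A = {w ; w^{χ} = 1 ∀ χ ∈ A}`. Then `Q = 0`: the exponents of `Q` are pairwise incongruent
mod `A`, so the characters `w ↦ w^e` of `T_A` they define are pairwise distinct
(`exists_torusPt`) and Dedekind–Artin independence of characters (`linearIndependent_monoidHom`)
kills every coefficient. [folklore] -/
theorem eq_zero_of_eval_torus {D₁ : ℕ} (Q : MvPolynomial (Fin n) ℂ)
    (hdeg : ∀ j, Q.degreeOf j ≤ D₁) (A : AddSubgroup (Fin n → ℤ))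
    (hsat : ∀ (k : ℤ) (χ : Fin n → ℤ), k ≠ 0 → k • χ ∈ A → χ ∈ A)
    (hbig : ∀ χ ∈ A, χ ≠ 0 → ∃ j, (D₁ : ℤ) < |χ j|) (b : Fin n → ℂˣ)
    (hvan : ∀ w : Fin n → ℂˣ, (∀ χ ∈ A, ∏ j, (w j) ^ (χ j) = 1) →
      MvPolynomial.eval (fun j => (b j : ℂ) * w j) Q = 0) :
    Q = 0 := by
  classical
  -- the subtorus as a group (`ℂ ×` the torus part, the additive factor is irrelevant)
  let H : ConnAlgSubgroup n := ⟨true, A, hsat⟩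
  let T : Subgroup (GaGm n) := H.toSubgroup
  have hmemT : ∀ g : GaGm n, g ∈ T ↔ ∀ χ ∈ A, ∏ j, (g.2 j) ^ (χ j) = 1 := fun g => by
    show ((H.addPart = false → g.1 = 1) ∧ ∀ χ ∈ H.chars, ∏ j, (g.2 j) ^ (χ j) = 1) ↔ _
    simp [H]
  -- the characters `w ↦ w^e` of `T`, `e` an exponent
  let ch : (Fin n →₀ ℕ) → (↥T →* ℂ) := fun e =>
    { toFun := fun g => ∏ j, (((g : GaGm n).2 j : ℂˣ) : ℂ) ^ (e j)
      map_one' := by simp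
      map_mul' := fun g g' => by
        simp only [Subgroup.coe_mul, Prod.snd_mul, Pi.mul_apply, Units.val_mul, mul_pow,
          Finset.prod_mul_distrib] }
  have ch_apply : ∀ e (g : ↥T), ch e g = ∏ j, (((g : GaGm n).2 j : ℂˣ) : ℂ) ^ (e j) :=
    fun e g => rfl
  -- distinct exponents of `Q` give distinct characters
  have hinj : ∀ e ∈ Q.support, ∀ e' ∈ Q.support, ch e = ch e' → e = e' := by
    intro e he e' he' hee
    by_contra hne
    set χ : Fin n → ℤ := fun j => (e j : ℤ) - e' j with hχ
    have hχ0 : χ ≠ 0 := by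
      intro h0
      apply hne
      ext j
      have := congrFun h0 j
      simp only [hχ, Pi.zero_apply, sub_eq_zero] at this
      exact_mod_cast this
    have hχA : χ ∉ A := by
      intro hA
      obtain ⟨j, hj⟩ := hbig χ hA hχ0
      have h1 : e j ≤ D₁ := (MvPolynomial.monomial_le_degreeOf j he).trans (hdeg j)
      have h2 : e' j ≤ D₁ := (MvPolynomial.monomial_le_degreeOf j he').trans (hdeg j)
      have : |χ j| ≤ (D₁ : ℤ) := by
        simp only [hχ]
        rw [abs_le]
        constructor <;> omega
      omega
    obtain ⟨w, hwA, hwχ⟩ := exists_torusPt hsat hχA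
    let g : GaGm n := (1, w)
    have hg : g ∈ T := (hmemT g).mpr hwA
    have heq := congrArg (fun f : ↥T →* ℂ => f ⟨g, hg⟩) hee
    simp only [ch_apply] at heq
    apply hwχ
    -- `∏ w^e = ∏ w^{e'}` in `ℂ` gives `w^χ = 1` in `ℂˣ`
    rw [← Units.val_eq_one, Units.coe_prod]
    have hw0 : ∀ j, ((w j : ℂˣ) : ℂ) ≠ 0 := fun j => (w j).ne_zero
    calc ∏ j, (((w j) ^ (χ j) : ℂˣ) : ℂ) = ∏ j, (((w j : ℂˣ) : ℂ) ^ (e j) / ((w j : ℂˣ) : ℂ) ^ (e' j)) := by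
          refine Finset.prod_congr rfl fun j _ => ?_
          rw [Units.val_zpow_eq_zpow_val, hχ]
          simp only
          rw [zpow_sub₀ (hw0 j), zpow_natCast, zpow_natCast]
      _ = (∏ j, ((w j : ℂˣ) : ℂ) ^ (e j)) / ∏ j, ((w j : ℂˣ) : ℂ) ^ (e' j) := by
          rw [Finset.prod_div_distrib]
      _ = 1 := by
          rw [div_eq_one_iff_eq (Finset.prod_ne_zero_iff.mpr fun j _ => pow_ne_zero _ (hw0 j))]
          exact heq
  -- the vanishing as a linear relation between characters
  let a : (Fin n →₀ ℕ) → ℂ := fun e => Q.coeff e * ∏ j, ((b j : ℂˣ) : ℂ) ^ (e j)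
  have hrel : ∑ e : ↥Q.support, a e • ((ch e : ↥T →* ℂ) : ↥T → ℂ) = 0 := by
    funext g
    simp only [Finset.sum_apply, Pi.smul_apply, smul_eq_mul, Pi.zero_apply]
    rw [Finset.sum_coe_sort Q.support (fun e => a e * (ch e : ↥T →* ℂ) g)]
    have hgT : ∀ χ ∈ A, ∏ j, ((g : GaGm n).2 j) ^ (χ j) = 1 := (hmemT g).mp g.2
    have hv := hvan (g : GaGm n).2 hgT
    rw [MvPolynomial.eval_eq'] at hv
    rw [← hv]
    refine Finset.sum_congr rfl fun e _ => ?_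
    simp only [a, ch_apply, mul_pow, Finset.prod_mul_distrib]
    ring
  have hli : LinearIndependent ℂ fun e : ↥Q.support => ((ch e : ↥T →* ℂ) : ↥T → ℂ) := by
    have h0 := linearIndependent_monoidHom (↥T) ℂ
    refine h0.comp (fun e : ↥Q.support => ch e) ?_
    intro e e' hee
    exact Subtype.ext (hinj e e.2 e' e'.2 hee)
  have hzero : ∀ e : ↥Q.support, a e = 0 :=
    Fintype.linearIndependent_iff.mp hli (fun e : ↥Q.support => a e) hrel
  -- hence every coefficient vanishes
  ext e
  rw [MvPolynomial.coeff_zero]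
  by_cases he : e ∈ Q.support
  · have := hzero ⟨e, he⟩
    simp only [a, mul_eq_zero] at this
    rcases this with h | h
    · exact h
    · exact absurd h (Finset.prod_ne_zero_iff.mpr fun j _ => pow_ne_zero _ (b j).ne_zero)
  · exact MvPolynomial.notMem_support_iff.mp he

/-- Coordinates of a product in `G(ℂ) = ℂ × (ℂˣ)ⁿ`. [folklore] -/
theorem coord_mul (g h : GaGm n) :
    coord (g * h) = Fin.cons (Multiplicative.toAdd g.1 + Multiplicative.toAdd h.1)
      (fun j => ((g.2 j : ℂˣ) : ℂ) * ((h.2 j : ℂˣ) : ℂ)) := by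
  ext i
  refine Fin.cases ?_ (fun j => ?_) i
  · simp [coord, toAdd_mul]
  · simp [coord]

/-- **A polynomial vanishing on a translate of `G' = ℂ × T_A` is zero, when `A` has no non-zero
character in the box `max |χⱼ| ≤ D₁ ≥ deg_{Y_j} P`.** For `w ∈ T_A` the one-variable polynomial
`t ↦ P(a + t, b·w)` vanishes identically, so every coefficient `Qᵢ ∈ ℂ[Y]` of `P` as a polynomial
in `X` (`finSuccEquiv`) vanishes on `b·T_A`, and `eq_zero_of_eval_torus` applies to it.
[folklore] -/
theorem eq_zero_of_evalAt_translate {D₁ : ℕ} (P : MvPolynomial (Fin (n + 1)) ℂ)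
    (hdeg : ∀ h : Fin n, P.degreeOf h.succ ≤ D₁) (H : ConnAlgSubgroup n)
    (hadd : H.addPart = true) (hbig : ∀ χ ∈ H.chars, χ ≠ 0 → ∃ j, (D₁ : ℤ) < |χ j|)
    (g : GaGm n) (hg : ∀ h ∈ H.toSubgroup, evalAt P (g * h) = 0) : P = 0 := by
  classical
  set F := MvPolynomial.finSuccEquiv ℂ n P with hF
  -- each coefficient of `F` vanishes on `b · T_A`, `b = g.2`
  have hcoef : ∀ i, ∀ w : Fin n → ℂˣ, (∀ χ ∈ H.chars, ∏ j, (w j) ^ (χ j) = 1) →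
      MvPolynomial.eval (fun j => ((g.2 j : ℂˣ) : ℂ) * w j) (F.coeff i) = 0 := by
    intro i w hw
    -- the polynomial `t ↦ P(t, b w)` vanishes identically
    set R : Polynomial ℂ := Polynomial.map (MvPolynomial.eval fun j => ((g.2 j : ℂˣ) : ℂ) * w j) F
      with hR
    have hR0 : R = 0 := by
      apply Polynomial.funext
      intro t
      rw [Polynomial.eval_zero]
      let h : GaGm n := (Multiplicative.ofAdd (t - Multiplicative.toAdd g.1), w)
      have hh : h ∈ H.toSubgroup := by
        refine ⟨fun hf => ?_, hw⟩
        rw [hadd] at hf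
        exact absurd hf (by decide)
      have hv := hg h hh
      rw [evalAt, coord_mul] at hv
      have e1 : Multiplicative.toAdd g.1 + Multiplicative.toAdd h.1 = t := by
        show Multiplicative.toAdd g.1 + (t - Multiplicative.toAdd g.1) = t
        ring
      rw [e1, MvPolynomial.eval_eq_eval_mv_eval'] at hv
      rw [hR, hF]
      exact hv
    have := congrArg (fun p => Polynomial.coeff p i) hR0
    simp only [hR, Polynomial.coeff_map, Polynomial.coeff_zero] at this
    exact this
  have hcoef0 : ∀ i, F.coeff i = 0 := fun i =>
    eq_zero_of_eval_torus (F.coeff i)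
      (fun j => (MvPolynomial.degreeOf_coeff_finSuccEquiv P j i).trans (hdeg j))
      H.chars H.saturated hbig g.2 (hcoef i)
  have hF0 : F = 0 := Polynomial.ext fun i => by rw [hcoef0 i, Polynomial.coeff_zero]
  have : MvPolynomial.finSuccEquiv ℂ n P = MvPolynomial.finSuccEquiv ℂ n 0 := by
    rw [← hF, hF0, map_zero]
  exact (MvPolynomial.finSuccEquiv ℂ n).injective this

/-! ### The analytic line `W = ℂ·(1, ũ)` against the tangent spaces -/

/-- Membership in `Lie T'`. [folklore] -/
theorem mem_torusTangent_iff (H : ConnAlgSubgroup n) (v : Fin n → ℂ) :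
    v ∈ H.torusTangent ↔ ∀ χ ∈ H.chars, ∑ j, (χ j : ℂ) * v j = 0 := Iff.rfl

/-- Membership of `(1, ũ)` in `Lie G'`: `G'` must contain `𝔾ₐ` and `ũ ∈ Lie T'`. [folklore] -/
theorem one_mem_tangent_iff (H : ConnAlgSubgroup n) (u' : Fin n → ℂ) :
    ((1 : ℂ), u') ∈ H.tangent ↔ H.addPart = true ∧ ∀ χ ∈ H.chars, ∑ j, (χ j : ℂ) * u' j = 0 := by
  unfold ConnAlgSubgroup.tangent
  rw [Submodule.mem_prod, mem_torusTangent_iff]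
  cases H.addPart <;> simp

/-- The line `ℂ·w₀` meets a subspace not containing `w₀` trivially. [folklore] -/
theorem span_singleton_inf_eq_bot {V : Type*} [AddCommGroup V] [Module ℂ V] {w₀ : V}
    {U : Submodule ℂ V} (h : w₀ ∉ U) : (ℂ ∙ w₀) ⊓ U = ⊥ := by
  rw [eq_bot_iff]
  intro x hx
  obtain ⟨hxW, hxU⟩ := Submodule.mem_inf.mp hx
  obtain ⟨c, rfl⟩ := Submodule.mem_span_singleton.mp hxW
  by_cases hc : c = 0
  · simp [hc]
  · exfalso
    apply h
    have : w₀ = c⁻¹ • (c • w₀) := by rw [smul_smul, inv_mul_cancel₀ hc, one_smul]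
    rw [this]
    exact U.smul_mem _ hxU

/-- `codim_W (W ∩ Lie G') = 1` when `(1, ũ) ∉ Lie G'`: then `dim W = 1` and
`dim (W ∩ Lie G') = 0`. [folklore] -/
theorem finrank_line_sub_eq_one (H : ConnAlgSubgroup n) (u' : Fin n → ℂ)
    (h : ((1 : ℂ), u') ∉ H.tangent) :
    Module.finrank ℂ ↥(ℂ ∙ ((1 : ℂ), u')) -
      Module.finrank ℂ ↥((ℂ ∙ ((1 : ℂ), u')) ⊓ H.tangent) = 1 := by
  have hw : ((1 : ℂ), u') ≠ 0 := fun h0 => one_ne_zero (congrArg Prod.fst h0)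
  rw [finrank_span_singleton hw, span_singleton_inf_eq_bot h, finrank_bot]

/-- The line `W = ℂ·(1, ũ)` has positive dimension. [folklore] -/
theorem finrank_line_pos (u' : Fin n → ℂ) : 0 < Module.finrank ℂ ↥(ℂ ∙ ((1 : ℂ), u')) := by
  have hw : ((1 : ℂ), u') ≠ 0 := fun h0 => one_ne_zero (congrArg Prod.fst h0)
  rw [finrank_span_singleton hw]
  exact Nat.one_pos

/-! ### The zero lemma with multiplicities -/

set_option maxHeartbeats 1600000 in
/-- **Zero lemma with multiplicities at the points `μ.v`, perturbed form** (the multiplicity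
analogue of Diaz's Lemme de zéros, J. Number Theory 31 (1989), pp. 11–12, obtained here from
Philippon's zero estimate `Philippon1986_GaGm` on `𝔾ₐ × 𝔾ₘⁿ`, Bull. SMF 114 (1986), Thm 2.1,
in the weakened form vendored in `PhilipponZeroEstimate.lean`: unspecified constant, total degree
in the torus variables, no degree clause on the obstructing subgroup). For `n ≥ 1` there is a
natural number `c = c(n)` such that: let `m ≥ 1`, `B, D₀, D₁ ≥ 1`, `T ≥ 0` be integers, `Δ ≥ π`,
`V` real; `u, ũ ∈ ℂⁿ`, `v, θ ∈ ℂ^m`, `z ∈ ℂ^{n×m}` with `∑|z_hk - u_hv_k| ≤ e^{-V}`,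
`∑|θ_k - v_k| ≤ e^{-V}`, `∑|ũ_h - u_h| ≤ e^{-V}`, `∑|z_hk| ≤ Δ`, `π|u₁| ≤ Δ`, `π|v₁| ≤ Δ`; let
`P ∈ ℂ[W₀, W₁, …, W_n]` be non-zero with `deg_{W₀} P ≤ D₀`, `deg_{W_h} P ≤ D₁`, vanishing to
order `≥ (n+1)T + 1` along the line `ℂ·(1, ũ)` of `Lie(𝔾ₐ × 𝔾ₘⁿ)` at every point
`σ(μ) = (μ.θ, (e^{μ.z_h})_h)`, `μ ∈ ℕ^m`, `max μ_k ≤ (n+1)B`. If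
`c D₀ D₁ⁿ < (T+1)(B+1)^m` and `c D₁ⁿ < (T+1)(B+1)^{m-1}`, then there are `λ ∈ ℤⁿ ∖ 0`,
`μ ∈ ℤ^m ∖ 0` with `|λ_h| ≤ D₁`, `|μ_k| ≤ D₁B²Δ` and `|λ.u|·|μ.v| ≤ D₁²B²Δ·e^{-V}`.

Proof (ours; the pattern is Waldschmidt's adaptation as reconstructed in
`DiazZeroLemmaProofs.lean`, the novelty being that the degree clause is not needed). Apply the
estimate with `Σ = σ([0,B]^m) ∋ e` (`Σ(n+1) ⊆ σ([0,(n+1)B]^m)`), `W = ℂ·(1,ũ)`: an algebraic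
subgroup `G' = V × T_A` in a translate of `𝒵(P)` with
`binom(T+s, s)·#(Σ/G')·D₀^{dim V}(nD₁)^{dim T_A} ≤ c·D₀(nD₁)ⁿ`, `s = 1 - dim(W ∩ Lie G')`.
(1) `V = 0`: `(1,ũ) ∉ Lie G'`, `s = 1`; either two points of the box are congruent — then
`ν = μ' - μ ≠ 0` has `ν.θ = 0`, `|ν.v| ≤ Be^{-V}`, take `(e₁, ν)` — or `#(Σ/G') = (B+1)^m` and the
count contradicts the first hypothesis. (2) `V = 𝔾ₐ` and `A` has a non-zero `χ` with
`max|χ_h| ≤ D₁`: if `(1,ũ) ∈ Lie G'` then `χ.ũ = 0`, `|χ.u| ≤ D₁e^{-V}`, take `(χ, e₁)`; otherwise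
`s = 1` and `(T+1)·#(Σ/G') ≤ c(nD₁)ⁿ`; if every class meets the box in `≤ B+1` points the count
contradicts the second hypothesis; a class with more points contains `μ₀, μ₁, μ₂` with independent
`ν = μ₁-μ₀`, `ν' = μ₂-μ₀` (`exists_indep_of_card_gt`) and `χ.(ν.z) = 2πit`, `χ.(ν'.z) = 2πit'`,
`2π|t|, 2π|t'| ≤ D₁BΔ`; then `ν` (if `t = 0`) or `ρ = t'ν - tν' ≠ 0` has `χ.(ρ.z) = 0`,
`|ρ_k| ≤ D₁B²Δ/π`, and `|χ.u||ρ.v| = |∑χ_hρ_k(u_hv_k - z_hk)| ≤ D₁·D₁B²Δ·e^{-V}`. (3) `V = 𝔾ₐ` and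
no such `χ`: `P` vanishes on a translate of `ℂ × T_A`, impossible for `P ≠ 0` of partial degrees
`≤ D₁` (`eq_zero_of_evalAt_translate`). The linear independence of `u`, `v` is not used.
[cite: Philippon1986, Thm 2.1 (the zero estimate used)]
[cite: Diaz1989, §II-3-4 Lemme de zéros, pp. 11–12 (the multiplicity-free model)] -/
theorem zeroLemmaMult_of_GaGm (hZ : Philippon1986_GaGm) (n : ℕ) (hn : 1 ≤ n) :
    ∃ c : ℕ, ∀ (m : ℕ) (hm : 1 ≤ m) (B T D₀ D₁ : ℕ) (V Δ : ℝ),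
      1 ≤ B → 1 ≤ D₀ → 1 ≤ D₁ → Real.pi ≤ Δ →
    ∀ (u u' : Fin n → ℂ) (v θ : Fin m → ℂ) (z : Fin n → Fin m → ℂ),
      (∑ h, ∑ k, ‖z h k - u h * v k‖) ≤ Real.exp (-V) →
      (∑ k, ‖θ k - v k‖) ≤ Real.exp (-V) →
      (∑ h, ‖u' h - u h‖) ≤ Real.exp (-V) →
      (∑ h, ∑ k, ‖z h k‖) ≤ Δ → Real.pi * ‖u ⟨0, hn⟩‖ ≤ Δ → Real.pi * ‖v ⟨0, hm⟩‖ ≤ Δ →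
    ∀ (P : MvPolynomial (Fin (n + 1)) ℂ), P ≠ 0 →
      P.degreeOf 0 ≤ D₀ → (∀ h : Fin n, P.degreeOf h.succ ≤ D₁) →
      (∀ μ : Fin m → ℕ, (∀ k, μ k ≤ (n + 1) * B) →
        VanishesToOrder P (ℂ ∙ ((1 : ℂ), u')) (sig θ z fun k => (μ k : ℤ)) ((n + 1) * T + 1)) →
      c * D₀ * D₁ ^ n < (T + 1) * (B + 1) ^ m →
      c * D₁ ^ n < (T + 1) * (B + 1) ^ (m - 1) →
      ∃ (lam : Fin n → ℤ) (mu : Fin m → ℤ), lam ≠ 0 ∧ mu ≠ 0 ∧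
        (∀ h, |lam h| ≤ (D₁ : ℤ)) ∧ (∀ k, (|mu k| : ℝ) ≤ D₁ * B ^ 2 * Δ) ∧
        ‖∑ h, (lam h : ℂ) * u h‖ * ‖∑ k, (mu k : ℂ) * v k‖ ≤
          D₁ ^ 2 * B ^ 2 * Δ * Real.exp (-V) := by
  classical
  obtain ⟨c, hc⟩ := hZ n
  refine ⟨c * n ^ n, ?_⟩
  intro m hm B T D₀ D₁ V Δ hB hD₀ hD₁ hΔ u u' v θ z hz hθ hu hzΔ huΔ hvΔ P hP0 hdeg₀ hdeg hvan
    hC1 hC2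
  -- Step 0: elementary real bounds used in every case.
  have hπ3 : (3 : ℝ) < Real.pi := Real.pi_gt_three
  have hΔ1 : (1 : ℝ) ≤ Δ := by linarith
  have hΔ0 : (0 : ℝ) ≤ Δ := by linarith
  have hB1 : (1 : ℝ) ≤ B := by exact_mod_cast hB
  have hD₁1 : (1 : ℝ) ≤ D₁ := by exact_mod_cast hD₁
  have hB2 : (B : ℝ) ≤ (B : ℝ) ^ 2 := by nlinarith
  have hD2 : (1 : ℝ) ≤ (D₁ : ℝ) ^ 2 := by nlinarith
  have hB21 : (1 : ℝ) ≤ (B : ℝ) ^ 2 := hB1.trans hB2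
  have hexp : 0 ≤ Real.exp (-V) := (Real.exp_pos _).le
  have F1 : (B : ℝ) ≤ D₁ * B ^ 2 * Δ := by
    calc (B : ℝ) = 1 * B * 1 := by ring
      _ ≤ D₁ * B ^ 2 * Δ := by gcongr
  have F2 : (1 : ℝ) ≤ D₁ * B ^ 2 * Δ := hB1.trans F1
  have GΔB : Δ * B ≤ (D₁ : ℝ) ^ 2 * B ^ 2 * Δ := by
    calc Δ * B = 1 * B * Δ := by ring
      _ ≤ D₁ ^ 2 * B ^ 2 * Δ := by gcongr
  have GD₁Δ : (D₁ : ℝ) * Δ ≤ (D₁ : ℝ) ^ 2 * B ^ 2 * Δ := by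
    calc (D₁ : ℝ) * Δ = D₁ * 1 * Δ := by ring
      _ ≤ D₁ ^ 2 * B ^ 2 * Δ := by
          gcongr
          nlinarith
  have GD₁B : (D₁ : ℝ) * B ≤ (D₁ : ℝ) ^ 2 * B ^ 2 * Δ := by
    calc (D₁ : ℝ) * B = D₁ * B * 1 := by ring
      _ ≤ D₁ ^ 2 * B ^ 2 * Δ := by
          gcongr
          nlinarith
  have hu0 : ‖u ⟨0, hn⟩‖ ≤ Δ := by nlinarith [norm_nonneg (u ⟨0, hn⟩)]
  have hv0 : ‖v ⟨0, hm⟩‖ ≤ Δ := by nlinarith [norm_nonneg (v ⟨0, hm⟩)]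
  -- Step 1: the box `[0, B]^m` and the points `σ(μ)`.
  set box : Finset (Fin m → ℕ) := Fintype.piFinset fun _ : Fin m => Finset.range (B + 1) with hbox
  have hmem_box : ∀ μ : Fin m → ℕ, μ ∈ box ↔ ∀ k, μ k ≤ B := fun μ => by
    simp only [hbox, Fintype.mem_piFinset, Finset.mem_range, Nat.lt_succ_iff]
  have hcard_box : box.card = (B + 1) ^ m := by
    simp [hbox, Fintype.card_piFinset]
  let toZ : (Fin m → ℕ) → Fin m → ℤ := fun μ k => (μ k : ℤ)
  let pt : (Fin m → ℕ) → GaGm n := fun μ => sig θ z (toZ μ)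
  set Sset : Set (GaGm n) := ↑(box.image pt) with hSset
  have hSfin : Sset.Finite := Finset.finite_toSet _
  have h0box : (0 : Fin m → ℕ) ∈ box := (hmem_box 0).mpr fun k => Nat.zero_le _
  have h1S : (1 : GaGm n) ∈ Sset := by
    rw [hSset, Finset.coe_image]
    refine ⟨0, by exact_mod_cast h0box, ?_⟩
    show sig θ z (toZ 0) = 1
    have : toZ 0 = 0 := by funext k; simp [toZ]
    rw [this, sig_zero]
  -- Step 2: the line `W` and the vanishing on `Σ(n+1)`.
  set W : Submodule ℂ (ℂ × (Fin n → ℂ)) := ℂ ∙ ((1 : ℂ), u') with hWdef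
  have hvanS : ∀ g ∈ sumset Sset (n + 1), VanishesToOrder P W g ((n + 1) * T + 1) := by
    rintro g ⟨σ', hσ', rfl⟩
    have hex : ∀ i, ∃ μ ∈ box, pt μ = σ' i := fun i => by
      have := hσ' i
      rw [hSset, Finset.coe_image] at this
      obtain ⟨μ, hμ, e⟩ := this
      exact ⟨μ, by exact_mod_cast hμ, e⟩
    choose μ hμbox hμeq using hex
    set Mv : Fin m → ℕ := fun k => ∑ i, μ i k with hMv
    have hMvle : ∀ k, Mv k ≤ (n + 1) * B := fun k => by
      rw [hMv]
      calc ∑ i, μ i k ≤ ∑ _i : Fin (n + 1), B :=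
            Finset.sum_le_sum fun i _ => (hmem_box _).mp (hμbox i) k
        _ = (n + 1) * B := by simp
    have hprod : ∏ i, σ' i = sig θ z (toZ Mv) := by
      have e1 : toZ Mv = ∑ i, toZ (μ i) := by
        funext k; simp [toZ, hMv]
      rw [e1, sig_sum]
      exact Finset.prod_congr rfl fun i _ => (hμeq i).symm
    rw [hprod]
    exact hvan Mv hMvle
  -- Step 3: the degree data and the zero estimate.
  have hdegtot : ∀ s ∈ P.support, ∑ j : Fin n, s (Fin.succ j) ≤ n * D₁ := by
    intro s hs
    calc ∑ j : Fin n, s (Fin.succ j) ≤ ∑ _j : Fin n, D₁ :=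
          Finset.sum_le_sum fun j _ => (MvPolynomial.monomial_le_degreeOf j.succ hs).trans (hdeg j)
      _ = n * D₁ := by simp
  have hnD₁ : 1 ≤ n * D₁ := by
    have := Nat.mul_le_mul hn hD₁
    simpa using this
  have hnD₁pos : 0 < n * D₁ := hnD₁
  obtain ⟨H, ⟨g, hg⟩, hineq⟩ :=
    hc D₀ (n * D₁) T W Sset P hD₀ hnD₁ (finrank_line_pos u') hSfin h1S hP0 hdeg₀ hdegtot hvanS
  -- Step 4: classes of the box modulo `G'` and the decoding of a congruence.
  let cls : (Fin m → ℕ) → GaGm n ⧸ H.toSubgroup := fun μ => (pt μ : GaGm n ⧸ H.toSubgroup)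
  have hncard : Set.ncard ((QuotientGroup.mk : GaGm n → GaGm n ⧸ H.toSubgroup) '' Sset) =
      (box.image cls).card := by
    rw [hSset, Finset.coe_image, Set.image_image, ← Finset.coe_image, Set.ncard_coe_finset]
  rw [hncard] at hineq
  have hcong : ∀ μ ∈ box, ∀ μ' ∈ box, cls μ = cls μ' →
      (∀ k, (|(toZ μ' - toZ μ) k| : ℝ) ≤ B) ∧
      (H.addPart = false → ∑ k, ((toZ μ' - toZ μ) k : ℂ) * θ k = 0) ∧
      ∀ χ ∈ H.chars, ∃ t : ℤ, pair z χ (toZ μ' - toZ μ) = t * (2 * Real.pi * Complex.I) := by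
    intro μ hμ μ' hμ' heq
    have hmem : sig θ z (toZ μ' - toZ μ) ∈ H.toSubgroup := by
      rw [← sig_inv_mul]; exact QuotientGroup.eq.mp heq
    rw [sig_mem_iff] at hmem
    refine ⟨fun k => ?_, hmem.1, hmem.2⟩
    have a := (hmem_box μ).mp hμ k
    have b := (hmem_box μ').mp hμ' k
    simp only [toZ, Pi.sub_apply, Int.cast_sub, Int.cast_natCast]
    rw [abs_le]
    constructor
    · have : (μ k : ℝ) ≤ B := by exact_mod_cast a
      have : (0 : ℝ) ≤ μ' k := Nat.cast_nonneg _
      linarith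
    · have : (μ' k : ℝ) ≤ B := by exact_mod_cast b
      have : (0 : ℝ) ≤ μ k := Nat.cast_nonneg _
      linarith
  have htoZ_inj : ∀ μ μ' : Fin m → ℕ, toZ μ' - toZ μ = 0 → μ = μ' := fun μ μ' h => by
    funext k
    have := congrFun h k
    simp only [toZ, Pi.sub_apply, Pi.zero_apply, sub_eq_zero] at this
    exact_mod_cast this.symm
  -- the two unit vectors
  have hsingle_u : ∑ h, ((Pi.single (⟨0, hn⟩ : Fin n) (1 : ℤ) : Fin n → ℤ) h : ℂ) * u h =
      u ⟨0, hn⟩ := by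
    rw [Finset.sum_eq_single ⟨0, hn⟩]
    · simp
    · intro h _ hne
      simp [Pi.single_eq_of_ne hne]
    · simp
  have hsingle_v : ∑ k, ((Pi.single (⟨0, hm⟩ : Fin m) (1 : ℤ) : Fin m → ℤ) k : ℂ) * v k =
      v ⟨0, hm⟩ := by
    rw [Finset.sum_eq_single ⟨0, hm⟩]
    · simp
    · intro k _ hne
      simp [Pi.single_eq_of_ne hne]
    · simp
  have hsingle_ne : ∀ {p : ℕ} (i : Fin p), (Pi.single i (1 : ℤ) : Fin p → ℤ) ≠ 0 := by
    intro p i h0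
    have := congrFun h0 i
    simp at this
  have hsingle_abs : ∀ {p : ℕ} (i j : Fin p), |(Pi.single i (1 : ℤ) : Fin p → ℤ) j| ≤ 1 := by
    intro p i j
    by_cases hj : j = i
    · subst hj; simp
    · rw [Pi.single_eq_of_ne hj, abs_zero]; exact zero_le_one
  have hsingle_absR : ∀ {p : ℕ} (i j : Fin p),
      (|(Pi.single i (1 : ℤ) : Fin p → ℤ) j| : ℝ) ≤ 1 := by
    intro p i j
    have := hsingle_abs i j
    exact_mod_cast this
  -- Step 5: the case analysis on `G' = V × T_A`.
  cases hadd : H.addPart with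
  | false =>
    -- (1) `V = 0`: the line is transverse, `s = 1`.
    have hnot : ((1 : ℂ), u') ∉ H.tangent := fun hmem' => by
      have := ((one_mem_tangent_iff H u').mp hmem').1
      rw [hadd] at this
      exact Bool.false_ne_true this
    have hs1 := finrank_line_sub_eq_one H u' hnot
    rw [hs1, Nat.choose_one_right] at hineq
    have haD : H.addDim = 0 := by simp [ConnAlgSubgroup.addDim, hadd]
    rw [haD, pow_zero, mul_one] at hineq
    by_cases hinj : Set.InjOn cls ↑box
    · -- no congruent pair: the count contradicts `hC1`
      exfalso
      have hcard : (box.image cls).card = (B + 1) ^ m := by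
        rw [Finset.card_image_of_injOn hinj, hcard_box]
      rw [hcard] at hineq
      have h1 : 1 ≤ (n * D₁) ^ H.torusDim := Nat.one_le_pow _ _ hnD₁pos
      have h2 : (T + 1) * (B + 1) ^ m ≤ c * D₀ * (n * D₁) ^ n :=
        le_trans (Nat.le_mul_of_pos_right _ h1) hineq
      rw [mul_pow] at h2
      have h3 : c * D₀ * (n ^ n * D₁ ^ n) = c * n ^ n * D₀ * D₁ ^ n := by ring
      rw [h3] at h2
      exact absurd (lt_of_le_of_lt h2 hC1) (lt_irrefl _)
    · -- a congruent pair `μ ≠ μ'`: `ν.θ = 0`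
      rw [Set.InjOn] at hinj
      push Not at hinj
      obtain ⟨μ, hμ, μ', hμ', heq, hne⟩ := hinj
      have hμb : μ ∈ box := Finset.mem_coe.mp hμ
      have hμ'b : μ' ∈ box := Finset.mem_coe.mp hμ'
      obtain ⟨hbnd, hθ0, -⟩ := hcong μ hμb μ' hμ'b heq
      set ν : Fin m → ℤ := toZ μ' - toZ μ with hν
      have hν0 : ν ≠ 0 := fun h0 => hne (htoZ_inj μ μ' h0)
      have hθsum : ∑ k, (ν k : ℂ) * θ k = 0 := hθ0 hadd
      refine ⟨Pi.single ⟨0, hn⟩ 1, ν, hsingle_ne _, hν0, fun h => ?_, fun k => (hbnd k).trans F1,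
        ?_⟩
      · exact (hsingle_abs _ h).trans (by exact_mod_cast hD₁)
      · have e2 : ∑ k, (ν k : ℂ) * v k = ∑ k, (ν k : ℂ) * (v k - θ k) := by
          have : ∑ k, (ν k : ℂ) * v k =
              ∑ k, (ν k : ℂ) * (v k - θ k) + ∑ k, (ν k : ℂ) * θ k := by
            rw [← Finset.sum_add_distrib]
            exact Finset.sum_congr rfl fun k _ => by ring
          rw [this, hθsum, add_zero]
        have hνv : ‖∑ k, (ν k : ℂ) * v k‖ ≤ B * Real.exp (-V) := by
          rw [e2]
          calc ‖∑ k, (ν k : ℂ) * (v k - θ k)‖ ≤ ∑ k, ‖(ν k : ℂ) * (v k - θ k)‖ := norm_sum_le _ _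
            _ ≤ ∑ k, (B : ℝ) * ‖θ k - v k‖ := Finset.sum_le_sum fun k _ => by
                rw [norm_mul, norm_sub_rev]
                refine mul_le_mul_of_nonneg_right ?_ (norm_nonneg _)
                have : ‖(ν k : ℂ)‖ = (|ν k| : ℝ) := by simp [Complex.norm_intCast]
                rw [this]; exact hbnd k
            _ = B * ∑ k, ‖θ k - v k‖ := by rw [Finset.mul_sum]
            _ ≤ B * Real.exp (-V) := mul_le_mul_of_nonneg_left hθ (by positivity)
        rw [hsingle_u]
        calc ‖u ⟨0, hn⟩‖ * ‖∑ k, (ν k : ℂ) * v k‖ ≤ Δ * (B * Real.exp (-V)) :=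
              mul_le_mul hu0 hνv (norm_nonneg _) hΔ0
          _ = Δ * B * Real.exp (-V) := by ring
          _ ≤ D₁ ^ 2 * B ^ 2 * Δ * Real.exp (-V) := mul_le_mul_of_nonneg_right GΔB hexp
  | true =>
    by_cases hsmall : ∃ χ ∈ H.chars, χ ≠ 0 ∧ ∀ h, |χ h| ≤ (D₁ : ℤ)
    · obtain ⟨χ, hχA, hχ0, hχD⟩ := hsmall
      have hχD' : ∀ h, (|χ h| : ℝ) ≤ D₁ := fun h => by
        have := hχD h
        exact_mod_cast this
      by_cases htan : ((1 : ℂ), u') ∈ H.tangent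
      · -- (2a) `s = 0`: every character of `A` kills `ũ`, so `χ.u` is tiny.
        have hu'0 : ∑ j, (χ j : ℂ) * u' j = 0 := ((one_mem_tangent_iff H u').mp htan).2 χ hχA
        refine ⟨χ, Pi.single ⟨0, hm⟩ 1, hχ0, hsingle_ne _, hχD,
          fun k => (hsingle_absR _ k).trans F2, ?_⟩
        have e2 : ∑ h, (χ h : ℂ) * u h = ∑ h, (χ h : ℂ) * (u h - u' h) := by
          have : ∑ h, (χ h : ℂ) * u h =
              ∑ h, (χ h : ℂ) * (u h - u' h) + ∑ h, (χ h : ℂ) * u' h := by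
            rw [← Finset.sum_add_distrib]
            exact Finset.sum_congr rfl fun h _ => by ring
          rw [this, hu'0, add_zero]
        have hχu : ‖∑ h, (χ h : ℂ) * u h‖ ≤ D₁ * Real.exp (-V) := by
          rw [e2]
          calc ‖∑ h, (χ h : ℂ) * (u h - u' h)‖ ≤ ∑ h, ‖(χ h : ℂ) * (u h - u' h)‖ :=
                norm_sum_le _ _
            _ ≤ ∑ h, (D₁ : ℝ) * ‖u' h - u h‖ := Finset.sum_le_sum fun h _ => by
                rw [norm_mul, norm_sub_rev]
                refine mul_le_mul_of_nonneg_right ?_ (norm_nonneg _)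
                have : ‖(χ h : ℂ)‖ = (|χ h| : ℝ) := by simp [Complex.norm_intCast]
                rw [this]; exact hχD' h
            _ = D₁ * ∑ h, ‖u' h - u h‖ := by rw [Finset.mul_sum]
            _ ≤ D₁ * Real.exp (-V) := mul_le_mul_of_nonneg_left hu (by positivity)
        rw [hsingle_v]
        calc ‖∑ h, (χ h : ℂ) * u h‖ * ‖v ⟨0, hm⟩‖ ≤ D₁ * Real.exp (-V) * Δ :=
              mul_le_mul hχu hv0 (norm_nonneg _) (by positivity)
          _ = D₁ * Δ * Real.exp (-V) := by ring
          _ ≤ D₁ ^ 2 * B ^ 2 * Δ * Real.exp (-V) := mul_le_mul_of_nonneg_right GD₁Δ hexp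
      · -- (2b) `s = 1`: count the classes with the small character `χ`.
        have hs1 := finrank_line_sub_eq_one H u' htan
        rw [hs1, Nat.choose_one_right] at hineq
        have haD : H.addDim = 1 := by simp [ConnAlgSubgroup.addDim, hadd]
        rw [haD, pow_one] at hineq
        have hineq' : (T + 1) * (box.image cls).card ≤ c * (n * D₁) ^ n := by
          have h1 : 1 ≤ (n * D₁) ^ H.torusDim := Nat.one_le_pow _ _ hnD₁pos
          have h2 : (T + 1) * (box.image cls).card * D₀ ≤ c * (n * D₁) ^ n * D₀ := by
            calc (T + 1) * (box.image cls).card * D₀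
                ≤ (T + 1) * (box.image cls).card * D₀ * (n * D₁) ^ H.torusDim :=
                  Nat.le_mul_of_pos_right _ h1
              _ ≤ c * D₀ * (n * D₁) ^ n := hineq
              _ = c * (n * D₁) ^ n * D₀ := by ring
          exact Nat.le_of_mul_le_mul_right h2 (by omega)
        by_cases hfib : ∀ b ∈ box.image cls, (box.filter fun a => cls a = b).card ≤ B + 1
        · -- every class is thin: the count contradicts `hC2`
          exfalso
          have h3 : box.card ≤ (B + 1) * (box.image cls).card :=
            Finset.card_le_mul_card_image box (B + 1) hfib
          rw [hcard_box] at h3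
          obtain ⟨m', rfl⟩ : ∃ m', m = m' + 1 := ⟨m - 1, by omega⟩
          simp only [Nat.add_sub_cancel] at hC2
          have h4 : (B + 1) ^ m' ≤ (box.image cls).card := by
            rw [pow_succ, mul_comm] at h3
            exact Nat.le_of_mul_le_mul_left h3 (Nat.succ_pos B)
          have h5 : (T + 1) * (B + 1) ^ m' ≤ c * (n * D₁) ^ n :=
            le_trans (Nat.mul_le_mul_left _ h4) hineq'
          rw [mul_pow] at h5
          have h6 : c * (n ^ n * D₁ ^ n) = c * n ^ n * D₁ ^ n := by ring
          rw [h6] at h5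
          exact absurd (lt_of_le_of_lt h5 hC2) (lt_irrefl _)
        · -- a thick class: three points not on a line
          push Not at hfib
          obtain ⟨b, _hb, hcardC⟩ := hfib
          set C : Finset (Fin m → ℕ) := box.filter fun a => cls a = b with hCdef
          have hbx : ∀ μ ∈ C, μ ∈ box := fun μ hμ => (Finset.mem_filter.mp hμ).1
          have hcls : ∀ μ ∈ C, cls μ = b := fun μ hμ => (Finset.mem_filter.mp hμ).2
          have hCbox : ∀ μ ∈ C, ∀ k, μ k ≤ B := fun μ hμ k => (hmem_box μ).mp (hbx μ hμ) k
          obtain ⟨μ₀, hμ₀, μ₁, hμ₁, μ₂, hμ₂, hind⟩ := exists_indep_of_card_gt hCbox hcardC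
          obtain ⟨hb1, -, hpair1⟩ := hcong μ₀ (hbx _ hμ₀) μ₁ (hbx _ hμ₁)
            (by rw [hcls _ hμ₀, hcls _ hμ₁])
          obtain ⟨hb2, -, hpair2⟩ := hcong μ₀ (hbx _ hμ₀) μ₂ (hbx _ hμ₂)
            (by rw [hcls _ hμ₀, hcls _ hμ₂])
          set ν : Fin m → ℤ := toZ μ₁ - toZ μ₀ with hν
          set ν' : Fin m → ℤ := toZ μ₂ - toZ μ₀ with hν'
          obtain ⟨t, ht⟩ := hpair1 χ hχA
          obtain ⟨t', ht'⟩ := hpair2 χ hχA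
          have hνk : ∀ k, ν k = (μ₁ k : ℤ) - μ₀ k := fun k => rfl
          have hν'k : ∀ k, ν' k = (μ₂ k : ℤ) - μ₀ k := fun k => rfl
          have hν0 : ν ≠ 0 := by
            intro h0
            have := (hind 1 0 fun k => by
              have hk := congrFun h0 k
              rw [hνk] at hk
              simp only [Pi.zero_apply] at hk
              rw [hk]; ring).1
            exact one_ne_zero this
          have hbt : (|t| : ℝ) ≤ D₁ * B * Δ / (2 * Real.pi) :=
            abs_t_le' (abs_t_le hχD' hb1 (by positivity) ht) hzΔ (by positivity) (by positivity)
          have hbt' : (|t'| : ℝ) ≤ D₁ * B * Δ / (2 * Real.pi) :=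
            abs_t_le' (abs_t_le hχD' hb2 (by positivity) ht') hzΔ (by positivity) (by positivity)
          by_cases ht0 : t = 0
          · -- `χ.(ν.z) = 0`
            have hpair0 : pair z χ ν = 0 := by rw [ht, ht0]; simp
            refine ⟨χ, ν, hχ0, hν0, hχD, fun k => (hb1 k).trans F1, ?_⟩
            have key := norm_mul_norm_le (u := u) (v := v) hχD' hb1 (by positivity) hpair0
            calc ‖∑ h, (χ h : ℂ) * u h‖ * ‖∑ k, (ν k : ℂ) * v k‖
                ≤ D₁ * B * ∑ h, ∑ k, ‖z h k - u h * v k‖ := key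
              _ ≤ D₁ * B * Real.exp (-V) := mul_le_mul_of_nonneg_left hz (by positivity)
              _ ≤ D₁ ^ 2 * B ^ 2 * Δ * Real.exp (-V) := mul_le_mul_of_nonneg_right GD₁B hexp
          · -- `ρ = t'ν - tν'`
            set ρ : Fin m → ℤ := t' • ν - t • ν' with hρ
            have hρ0 : ρ ≠ 0 := by
              intro h0
              have := (hind t' (-t) fun k => by
                have hk := congrFun h0 k
                simp only [hρ, Pi.sub_apply, Pi.smul_apply, smul_eq_mul, Pi.zero_apply] at hk
                rw [hνk, hν'k] at hk
                linarith).2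
              exact ht0 (by omega)
            have hpairρ : pair z χ ρ = 0 := by
              rw [hρ, pair_lin_right, ht, ht']; ring
            have hρK : ∀ k, (|ρ k| : ℝ) ≤ D₁ * B ^ 2 * Δ := fun k => by
              have h1 := abs_comb_le (lam₁ := ν) (lam₂ := ν') hb1 hb2 hbt hbt' k
              have e : 2 * (D₁ * B * Δ / (2 * Real.pi)) * (B : ℝ) = D₁ * B ^ 2 * Δ / Real.pi := by
                field_simp
              rw [hρ]
              refine h1.trans ?_
              rw [e]
              exact div_le_self (by positivity) (by linarith)
            refine ⟨χ, ρ, hχ0, hρ0, hχD, hρK, ?_⟩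
            have key := norm_mul_norm_le (u := u) (v := v) hχD' hρK (by positivity) hpairρ
            calc ‖∑ h, (χ h : ℂ) * u h‖ * ‖∑ k, (ρ k : ℂ) * v k‖
                ≤ D₁ * (D₁ * B ^ 2 * Δ) * ∑ h, ∑ k, ‖z h k - u h * v k‖ := key
              _ ≤ D₁ * (D₁ * B ^ 2 * Δ) * Real.exp (-V) :=
                  mul_le_mul_of_nonneg_left hz (by positivity)
              _ = D₁ ^ 2 * B ^ 2 * Δ * Real.exp (-V) := by ring
    · -- (3) no small character: `P` would vanish on a translate of `ℂ × T_A`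
      push Not at hsmall
      exact absurd (eq_zero_of_evalAt_translate P hdeg H hadd hsmall g hg) hP0

/-! ### The order of vanishing along a line, in terms of ordinary derivatives -/

/-- Coordinates of `g · exp_G(t w₀)`: `(g₀ + t w₀,₀, (g_j e^{t w₀,j})_j)`. [folklore] -/
theorem coord_mul_exp_smul (g : GaGm n) (w₀ : ℂ × (Fin n → ℂ)) (t : ℂ) :
    coord (g * GaGm.exp (t • w₀)) =
      Fin.cons (Multiplicative.toAdd g.1 + t * w₀.1)
        (fun j => ((g.2 j : ℂˣ) : ℂ) * Complex.exp (t * w₀.2 j)) := by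
  rw [coord_mul]
  congr 1

/-- `t ↦ P(g · exp_G(t w₀))` is smooth (a polynomial in `t` and exponentials `e^{ct}`).
[folklore] -/
theorem contDiff_evalAt_mul_exp_smul {N : WithTop ℕ∞} (P : MvPolynomial (Fin (n + 1)) ℂ)
    (g : GaGm n) (w₀ : ℂ × (Fin n → ℂ)) :
    ContDiff ℂ N (fun t : ℂ => evalAt P (g * GaGm.exp (t • w₀))) := by
  have hcoord : ∀ i : Fin (n + 1), ContDiff ℂ N (fun t : ℂ => coord (g * GaGm.exp (t • w₀)) i) := by
    intro i
    simp only [coord_mul_exp_smul]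
    refine Fin.cases ?_ (fun j => ?_) i
    · simp only [Fin.cons_zero]
      exact contDiff_const.add (contDiff_id.mul contDiff_const)
    · simp only [Fin.cons_succ]
      exact contDiff_const.mul (Complex.contDiff_exp.comp (contDiff_id.mul contDiff_const))
  simp only [evalAt, MvPolynomial.eval_eq']
  refine ContDiff.sum fun d _ => contDiff_const.mul ?_
  exact contDiff_prod fun i _ => (hcoord i).pow _

/-- **Order of vanishing along a line from ordinary derivatives.** If
`(d/dt)^k P(g · exp_G(t w₀))|_{t=0} = 0` for all `k < N` (`w₀ ≠ 0`), then `P` vanishes to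
order `≥ N` at `g` along the analytic line `exp_G(ℂ w₀)` in the sense of `GaGm.VanishesToOrder`
(Fréchet derivatives on the subspace `ℂ·w₀`). [folklore] -/
theorem vanishesToOrder_of_iteratedDeriv {P : MvPolynomial (Fin (n + 1)) ℂ}
    {w₀ : ℂ × (Fin n → ℂ)} (hw₀ : w₀ ≠ 0) {g : GaGm n} {N : ℕ}
    (h : ∀ k < N, iteratedDeriv k (fun t : ℂ => evalAt P (g * GaGm.exp (t • w₀))) 0 = 0) :
    VanishesToOrder P (ℂ ∙ w₀) g N := by
  intro k hk
  set f : ↥(ℂ ∙ w₀) → ℂ := fun w => evalAt P (g * GaGm.exp (w : ℂ × (Fin n → ℂ))) with hf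
  let e : ℂ ≃L[ℂ] ↥(ℂ ∙ w₀) :=
    (LinearEquiv.toSpanNonzeroSingleton ℂ (ℂ × (Fin n → ℂ)) w₀ hw₀).toContinuousLinearEquiv
  have he : ∀ t : ℂ, ((e t : ↥(ℂ ∙ w₀)) : ℂ × (Fin n → ℂ)) = t • w₀ := fun t => rfl
  have hfe : f ∘ e = fun t => evalAt P (g * GaGm.exp (t • w₀)) := by
    funext t
    simp only [Function.comp_apply, hf, he]
  have hcd : ContDiff ℂ k (f ∘ e) := by
    rw [hfe]
    exact contDiff_evalAt_mul_exp_smul P g w₀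
  have key := ContinuousLinearMap.iteratedFDeriv_comp_right (e.symm : ↥(ℂ ∙ w₀) →L[ℂ] ℂ) hcd
    (0 : ↥(ℂ ∙ w₀)) (i := k) le_rfl
  have hcomp : (f ∘ ⇑e) ∘ ⇑(e.symm : ↥(ℂ ∙ w₀) →L[ℂ] ℂ) = f := by
    funext w
    simp
  rw [hcomp] at key
  have h0 : iteratedFDeriv ℂ k (f ∘ e) ((e.symm : ↥(ℂ ∙ w₀) →L[ℂ] ℂ) 0) = 0 := by
    rw [map_zero, iteratedFDeriv_eq_equiv_comp, Function.comp_apply, hfe, h k hk, map_zero]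
  rw [key, h0]
  ext v
  simp

/-- **The zero lemma with multiplicities, derivative form**: as `zeroLemmaMult_of_GaGm`, with the
vanishing hypothesis stated through ordinary derivatives:
`(d/dt)^s P(σ(μ) · exp_G(t(1, ũ)))|_{t=0} = 0` for `s ≤ (n+1)T`, `max μ_k ≤ (n+1)B` — the form
in which Gel'fond's method with derivatives supplies it.
[cite: Philippon1986, Thm 2.1 (the zero estimate used)] -/
theorem zeroLemmaMult_of_GaGm' (hZ : Philippon1986_GaGm) (n : ℕ) (hn : 1 ≤ n) :
    ∃ c : ℕ, ∀ (m : ℕ) (hm : 1 ≤ m) (B T D₀ D₁ : ℕ) (V Δ : ℝ),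
      1 ≤ B → 1 ≤ D₀ → 1 ≤ D₁ → Real.pi ≤ Δ →
    ∀ (u u' : Fin n → ℂ) (v θ : Fin m → ℂ) (z : Fin n → Fin m → ℂ),
      (∑ h, ∑ k, ‖z h k - u h * v k‖) ≤ Real.exp (-V) →
      (∑ k, ‖θ k - v k‖) ≤ Real.exp (-V) →
      (∑ h, ‖u' h - u h‖) ≤ Real.exp (-V) →
      (∑ h, ∑ k, ‖z h k‖) ≤ Δ → Real.pi * ‖u ⟨0, hn⟩‖ ≤ Δ → Real.pi * ‖v ⟨0, hm⟩‖ ≤ Δ →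
    ∀ (P : MvPolynomial (Fin (n + 1)) ℂ), P ≠ 0 →
      P.degreeOf 0 ≤ D₀ → (∀ h : Fin n, P.degreeOf h.succ ≤ D₁) →
      (∀ μ : Fin m → ℕ, (∀ k, μ k ≤ (n + 1) * B) → ∀ s < (n + 1) * T + 1,
        iteratedDeriv s (fun t : ℂ =>
          evalAt P (sig θ z (fun k => (μ k : ℤ)) * GaGm.exp (t • ((1 : ℂ), u')))) 0 = 0) →
      c * D₀ * D₁ ^ n < (T + 1) * (B + 1) ^ m →
      c * D₁ ^ n < (T + 1) * (B + 1) ^ (m - 1) →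
      ∃ (lam : Fin n → ℤ) (mu : Fin m → ℤ), lam ≠ 0 ∧ mu ≠ 0 ∧
        (∀ h, |lam h| ≤ (D₁ : ℤ)) ∧ (∀ k, (|mu k| : ℝ) ≤ D₁ * B ^ 2 * Δ) ∧
        ‖∑ h, (lam h : ℂ) * u h‖ * ‖∑ k, (mu k : ℂ) * v k‖ ≤
          D₁ ^ 2 * B ^ 2 * Δ * Real.exp (-V) := by
  obtain ⟨c, hc⟩ := zeroLemmaMult_of_GaGm hZ n hn
  refine ⟨c, ?_⟩
  intro m hm B T D₀ D₁ V Δ hB hD₀ hD₁ hΔ u u' v θ z hz hθ hu hzΔ huΔ hvΔ P hP0 hdeg₀ hdeg hvan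
    hC1 hC2
  have hw : ((1 : ℂ), u') ≠ 0 := fun h0 => one_ne_zero (congrArg Prod.fst h0)
  exact hc m hm B T D₀ D₁ V Δ hB hD₀ hD₁ hΔ u u' v θ z hz hθ hu hzΔ huΔ hvΔ P hP0 hdeg₀ hdeg
    (fun μ hμ => vanishesToOrder_of_iteratedDeriv hw (hvan μ hμ)) hC1 hC2

end DiazZLM

end Literature.NumberTheory.Transcendental

end
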